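import Literature.NumberTheory.Transcendental.DiazZeroFree
import Literature.NumberTheory.Transcendental.DiazSmallness
import Literature.NumberTheory.Transcendental.DiazMain
import HarnessLib

/-!
# Diaz 1989, Théorème 1 — §II-3-4 (end): the `Q_{μj}` have no common zero in the ball `𝓑_ρ`

Topic `Literature/NumberTheory/Transcendental` (trunk T-TRANSCEND). Decomposition step for the
named fact `Literature.NumberTheory.Transcendental.Diaz1989_thm1` (`DiazMain.lean`), continuing
`DiazZeroFree.lean`: there, §II-3-4 of G. Diaz, J. Number Theory 31 (1989), pp. 11–14, was
brought to the alternative `exists_aeval_Qj_ne_zero_or` — at a point `θ̃` of the ball, with `j` a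
minimal index at `θ̃`, either some `Q_{μj}(θ̃) ≠ 0` (`|μ| < M₁`) or the zero lemma produces a
non-zero pair `(λ, μ)` with the bounds (12). Here we finish the section for the parameters of
§II-4-1 (`DiazParams.lean`):

* `ball_hyps` — the hypotheses (10) of the zero lemma hold at every `θ̃ ∈ 𝓑_ρ`
  (`max |θ̃ᵢ - θᵢ| ≤ e^{-ρ}`) with `V = ρ/2` and the constant `Δ = Δ₀(u, v)` (`Delta0`), once
  `ρ ≥ 4(∑|e^{-u_hv_k}| + m + 1)` (Diaz, p. 14, takes `V = ρ - c₁₅`);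
* `eventually_C9` — the constraint (𝒞9) (p. 14): by the technical hypothesis (HT1) ((a) for `u`
  with exponent `ηa`, `(2m+n-1)ηa < m(n+1)`; (b) for `v` with exponent `ηb`,
  `(m+2n+1)ηb ≤ m(n+1)`, `ηb < n+1` — Diaz's `m(n+1)/(2m+n)` and `m(n+1)/(m+2n+1)` qualify, the
  second one sharply: the margin is the power `(log X)^{1 - m/(m+2n+1)}`), for all large `X` no
  non-zero `(λ, μ)` satisfies (12) with `D₁ = L - 1`, `S = M₁ - 1`, `V = ρ/2`: the measures give
  `|λ.u|·|μ.v| ≥ exp(-2Ψ₀)`, `Ψ₀ = X^{m(n+1)} log X = ρ/(16(n+1))`, against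
  `|λ.u|·|μ.v| ≤ cΔ(L-1)²((M₁-1)/(n+1))² e^{-ρ/2} ≤ Ψ₀³e^{-8(n+1)Ψ₀}/2`;
* `eventually_zeroFree` — hence (with (𝒞7), (𝒞8) of `DiazParams.lean`), for all large `X`, at
  every `θ̃ ∈ 𝓑_ρ` and for every minimal index `j` at `θ̃`, some `Q_{μj}(θ̃) ≠ 0` with `|μ| < M₁`
  (Diaz, p. 14: "Les conditions (10) et (11) du lemme de zéros sont remplies, mais pas la
  conclusion. Donc …"). This is the input "no common zero in the ball" of Philippon's criterion.

Everything here is proved; the zero lemma enters as the hypothesis `ZeroLemmaAt n hn c`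
(supplied by the named fact `Diaz1989_zeroLemma`, `DiazZeroLemma.lean`).

## References

* G. Diaz, *Grands degrés de transcendance pour des familles d'exponentielles*, J. Number Theory
  31 (1989), 1–23, §II-3-4 (10)–(12), (𝒞9), pp. 12–14; §II-4-2, p. 15.
-/

noncomputable section

open Filter Real Finset Literature.NumberTheory.Transcendental.Asymp MvPolynomial

namespace Literature.NumberTheory.Transcendental

namespace DiazThm1

variable {m n : ℕ}

/-! ### Sizes of the bounds (12) for the chosen parameters -/

/-- `L - 1 ≤ a₁ X^{m-1}(log X)^{1/(n+1)}` (`X ≥ 1`). [folklore] -/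
theorem L_sub_one_le {X : ℝ} (hX : 1 ≤ X) :
    ((Lp m n X - 1 : ℕ) : ℝ) ≤ a1 m n * scale (m - 1 : ℕ) (1 / (n + 1 : ℝ)) X :=
  le_trans (by exact_mod_cast Nat.sub_le _ _) (L_le hX)

/-- `(M₁ - 1)/(n+1) ≤ a₂ X^{n+1}` (`X ≥ 1`). [folklore] -/
theorem M1_sub_one_div_le {X : ℝ} (hX : 1 ≤ X) :
    ((M1p m n X - 1 : ℕ) : ℝ) / (n + 1) ≤ a2 m n * scale (n + 1) 0 X := by
  have h1 : ((M1p m n X - 1 : ℕ) : ℝ) ≤ M1p m n X := by exact_mod_cast Nat.sub_le _ _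
  have h2 : (M1p m n X : ℝ) = a2 m n * Mp n X := by unfold M1p; push_cast; ring
  have h3 : (M1p m n X : ℝ) ≤ a2 m n * scale (n + 1) 0 X := by
    rw [h2]; exact mul_le_mul_of_nonneg_left (M_le hX) (Nat.cast_nonneg _)
  have hn1 : (1 : ℝ) ≤ n + 1 := by
    have : (0 : ℝ) ≤ n := Nat.cast_nonneg n
    linarith
  have h0 : 0 ≤ ((M1p m n X - 1 : ℕ) : ℝ) := Nat.cast_nonneg _
  calc ((M1p m n X - 1 : ℕ) : ℝ) / (n + 1) ≤ ((M1p m n X - 1 : ℕ) : ℝ) := div_le_self h0 hn1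
    _ ≤ _ := h1.trans h3

/-- The scale of the bound for `|λ|` in (12): `(L-1)²(M₁-1)/(n+1) ≤ a₁²a₂ X^{2(m-1)+(n+1)}(log X)^{2/(n+1)}`.
[cite: Diaz1989, §II-3-4 (12) p. 12] -/
theorem bound_lam_le {X : ℝ} (hX : 1 < X) :
    ((Lp m n X - 1 : ℕ) : ℝ) ^ 2 * (((M1p m n X - 1 : ℕ) : ℝ) / (n + 1)) ≤
      (a1 m n : ℝ) ^ 2 * a2 m n *
        scale (2 * ((m - 1 : ℕ) : ℝ) + (n + 1)) (2 * (1 / (n + 1 : ℝ))) X := by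
  have hL := L_sub_one_le (m := m) (n := n) hX.le
  have hM := M1_sub_one_div_le (m := m) (n := n) hX.le
  have hs1 := scale_nonneg (a := (m - 1 : ℕ)) (b := 1 / (n + 1 : ℝ)) hX.le
  have hs2 := scale_nonneg (a := n + 1) (b := 0) hX.le
  calc ((Lp m n X - 1 : ℕ) : ℝ) ^ 2 * (((M1p m n X - 1 : ℕ) : ℝ) / (n + 1))
      ≤ (a1 m n * scale (m - 1 : ℕ) (1 / (n + 1 : ℝ)) X) ^ 2 * (a2 m n * scale (n + 1) 0 X) :=
        mul_le_mul (pow_le_pow_left₀ (Nat.cast_nonneg _) hL 2) hM (by positivity) (by positivity)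
    _ = (a1 m n : ℝ) ^ 2 * a2 m n *
          (scale (m - 1 : ℕ) (1 / (n + 1 : ℝ)) X ^ (2 : ℕ) * scale (n + 1) 0 X) := by ring
    _ = _ := by
        rw [scale_pow hX.le, scale_mul_scale hX]
        congr 1
        push_cast
        ring_nf

/-- The scale of the bound for `|μ|` in (12): `(L-1)((M₁-1)/(n+1))² ≤ a₁a₂² X^{(m-1)+2(n+1)}(log X)^{1/(n+1)}`.
[cite: Diaz1989, §II-3-4 (12) p. 12] -/
theorem bound_mu_le {X : ℝ} (hX : 1 < X) :
    ((Lp m n X - 1 : ℕ) : ℝ) * (((M1p m n X - 1 : ℕ) : ℝ) / (n + 1)) ^ 2 ≤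
      (a1 m n : ℝ) * (a2 m n) ^ 2 *
        scale (((m - 1 : ℕ) : ℝ) + 2 * (n + 1)) (1 / (n + 1 : ℝ)) X := by
  have hL := L_sub_one_le (m := m) (n := n) hX.le
  have hM := M1_sub_one_div_le (m := m) (n := n) hX.le
  have hs1 := scale_nonneg (a := (m - 1 : ℕ)) (b := 1 / (n + 1 : ℝ)) hX.le
  have hs2 := scale_nonneg (a := n + 1) (b := 0) hX.le
  have h0 : 0 ≤ ((M1p m n X - 1 : ℕ) : ℝ) / (n + 1) := by positivity
  calc ((Lp m n X - 1 : ℕ) : ℝ) * (((M1p m n X - 1 : ℕ) : ℝ) / (n + 1)) ^ 2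
      ≤ (a1 m n * scale (m - 1 : ℕ) (1 / (n + 1 : ℝ)) X) * (a2 m n * scale (n + 1) 0 X) ^ 2 :=
        mul_le_mul hL (pow_le_pow_left₀ h0 hM 2) (by positivity) (by positivity)
    _ = (a1 m n : ℝ) * (a2 m n) ^ 2 *
          (scale (m - 1 : ℕ) (1 / (n + 1 : ℝ)) X * scale (n + 1) 0 X ^ (2 : ℕ)) := by ring
    _ = _ := by
        rw [scale_pow hX.le, scale_mul_scale hX]
        congr 1
        push_cast
        ring_nf

/-- The scale of the bound for `|λ.u|·|μ.v|` in (12):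
`(L-1)²((M₁-1)/(n+1))² ≤ a₁²a₂² X^{2(m-1)+2(n+1)}(log X)^{2/(n+1)}`. [cite: Diaz1989, §II-3-4 (12) p. 12] -/
theorem bound_prod_le {X : ℝ} (hX : 1 < X) :
    ((Lp m n X - 1 : ℕ) : ℝ) ^ 2 * (((M1p m n X - 1 : ℕ) : ℝ) / (n + 1)) ^ 2 ≤
      (a1 m n : ℝ) ^ 2 * (a2 m n) ^ 2 *
        scale (2 * ((m - 1 : ℕ) : ℝ) + 2 * (n + 1)) (2 * (1 / (n + 1 : ℝ))) X := by
  have hL := L_sub_one_le (m := m) (n := n) hX.le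
  have hM := M1_sub_one_div_le (m := m) (n := n) hX.le
  have hs1 := scale_nonneg (a := (m - 1 : ℕ)) (b := 1 / (n + 1 : ℝ)) hX.le
  have hs2 := scale_nonneg (a := n + 1) (b := 0) hX.le
  have h0 : 0 ≤ ((M1p m n X - 1 : ℕ) : ℝ) / (n + 1) := by positivity
  calc ((Lp m n X - 1 : ℕ) : ℝ) ^ 2 * (((M1p m n X - 1 : ℕ) : ℝ) / (n + 1)) ^ 2
      ≤ (a1 m n * scale (m - 1 : ℕ) (1 / (n + 1 : ℝ)) X) ^ 2 * (a2 m n * scale (n + 1) 0 X) ^ 2 :=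
        mul_le_mul (pow_le_pow_left₀ (Nat.cast_nonneg _) hL 2) (pow_le_pow_left₀ h0 hM 2)
          (by positivity) (by positivity)
    _ = (a1 m n : ℝ) ^ 2 * (a2 m n) ^ 2 *
          (scale (m - 1 : ℕ) (1 / (n + 1 : ℝ)) X ^ (2 : ℕ) * scale (n + 1) 0 X ^ (2 : ℕ)) := by ring
    _ = _ := by
        rw [scale_pow hX.le, scale_pow hX.le, scale_mul_scale hX]
        congr 1
        push_cast
        ring_nf


/-! ### (𝒞9): the technical hypothesis (HT1) excludes the small pair `(λ, μ)` of the zero lemma -/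

/-- Real powers of a quantity bounded by a multiple of a scale. [folklore] -/
theorem rpow_le_of_le_mul_scale {y K a b η X : ℝ} (hX : 1 ≤ X) (hK : 0 ≤ K) (hy : 0 ≤ y)
    (hη : 0 ≤ η) (h : y ≤ K * scale a b X) : y ^ η ≤ K ^ η * scale (a * η) (b * η) X := by
  calc y ^ η ≤ (K * scale a b X) ^ η := Real.rpow_le_rpow hy h hη
    _ = K ^ η * scale a b X ^ η := Real.mul_rpow hK (scale_nonneg hX)
    _ = _ := by rw [scale_rpow hX]

/-- Scales with nonnegative exponents are `≥ 1` for `X ≥ e`. [folklore] -/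
theorem one_le_scale {a b X : ℝ} (ha : 0 ≤ a) (hb : 0 ≤ b) (hX : Real.exp 1 ≤ X) :
    1 ≤ scale a b X := by
  simpa using scale_le_scale ha hb hX

/-- (HT)(a) at the point `B + X(u) + 1`: a nonzero `λ` with `max |λᵢ| ≤ B` has
`|λ.u| ≥ exp(-(B + X(u) + 1)^η)`. [cite: Diaz1989, Théorème 1 (HT1)(a), p. 2] -/
theorem MeasureA.lower {ι : Type*} [Fintype ι] {u : ι → ℂ} {η : ℝ} (h : Diaz1989.MeasureA u η) :
    ∃ X₀ : ℝ, 0 < X₀ ∧ ∀ lam : ι → ℤ, lam ≠ 0 → ∀ B : ℝ, 0 ≤ B → (∀ i, (|lam i| : ℝ) ≤ B) →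
      Real.exp (-((B + X₀ + 1) ^ η)) ≤ ‖∑ i, (lam i : ℂ) * u i‖ := by
  obtain ⟨X₀, hX₀, hb⟩ := h
  refine ⟨X₀, hX₀, fun lam hlam B hB hle => hb lam hlam (B + X₀ + 1) (by linarith) fun i => ?_⟩
  linarith [hle i]

/-- (HT)(b) at the point `B + X(v) + 1`: a nonzero `μ` with `max |μ_k| ≤ B` has
`|μ.v| ≥ exp(-min(Y log Y, Y^η)) ≥ exp(-Y^η)`, `Y = B + X(v) + 1`.
[cite: Diaz1989, Théorème 1 (HT1)(b), p. 2] -/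
theorem MeasureB.lower {ι : Type*} [Fintype ι] {v : ι → ℂ} {η : ℝ} (h : Diaz1989.MeasureB v η) :
    ∃ X₀ : ℝ, 0 < X₀ ∧ ∀ mu : ι → ℤ, mu ≠ 0 → ∀ B : ℝ, 0 ≤ B → (∀ k, (|mu k| : ℝ) ≤ B) →
      Real.exp (-((B + X₀ + 1) ^ η)) ≤ ‖∑ k, (mu k : ℂ) * v k‖ := by
  obtain ⟨X₀, hX₀, hb⟩ := h
  refine ⟨X₀, hX₀, fun mu hmu B hB hle => le_trans ?_
    (hb mu hmu (B + X₀ + 1) (by linarith) fun k => by linarith [hle k])⟩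
  exact Real.exp_le_exp.mpr (neg_le_neg (min_le_right _ _))

/-- `P³/2 · e^{-8(n+1)P} < e^{-2P}` for `P ≥ 1` (the final numerical comparison in (𝒞9)). [folklore] -/
theorem half_cube_mul_exp_lt {P : ℝ} (hP : 1 ≤ P) (n : ℕ) :
    P ^ 3 / 2 * Real.exp (-(16 * (n + 1) * P / 2)) < Real.exp (-(2 * P)) := by
  have hP0 : 0 ≤ P := by linarith
  have h1 : P ^ 3 / 6 ≤ Real.exp P := by
    have := Real.pow_div_factorial_le_exp P hP0 3
    simpa [Nat.factorial] using this
  have h2 : (3 : ℝ) < Real.exp (5 * P) := by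
    have := Real.add_one_le_exp (5 * P)
    linarith
  have hn : (0 : ℝ) ≤ n := Nat.cast_nonneg n
  -- `P³/2 = 3 (P³/6) ≤ 3 e^P < e^{5P} e^P = e^{6P} ≤ e^{(8(n+1)-2)P}`
  have h3 : P ^ 3 / 2 < Real.exp (6 * P) := by
    calc P ^ 3 / 2 = 3 * (P ^ 3 / 6) := by ring
      _ ≤ 3 * Real.exp P := by linarith
      _ < Real.exp (5 * P) * Real.exp P :=
          mul_lt_mul_of_pos_right h2 (Real.exp_pos P)
      _ = Real.exp (6 * P) := by rw [← Real.exp_add]; ring_nf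
  have h4 : Real.exp (6 * P) ≤ Real.exp (16 * (n + 1) * P / 2 - 2 * P) :=
    Real.exp_le_exp.mpr (by nlinarith)
  have h5 := h3.trans_le h4
  rw [show Real.exp (16 * (n + 1) * P / 2 - 2 * P) =
      Real.exp (-(2 * P)) / Real.exp (-(16 * (n + 1) * P / 2)) by
    rw [← Real.exp_sub]; ring_nf] at h5
  rwa [lt_div_iff₀ (Real.exp_pos _)] at h5

/-- `B + X₀ + 1 ≤ (K + X₀ + 1) s` when `B ≤ K s`, `s ≥ 1`, `X₀ + 1 ≥ 0`. [folklore] -/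
theorem shift_le_mul_scale {B K X₀ s : ℝ} (hB : B ≤ K * s) (hs : 1 ≤ s) (hX₀ : 0 ≤ X₀ + 1) :
    B + X₀ + 1 ≤ (K + X₀ + 1) * s := by
  have h1 : (K + X₀ + 1) * s = K * s + (X₀ + 1) * s := by ring
  have h2 : (X₀ + 1) * 1 ≤ (X₀ + 1) * s := mul_le_mul_of_nonneg_left hs hX₀
  linarith

/-- **(𝒞9) at a fixed `X`** (the pointwise form of `eventually_C9`): if the three dominations
`Ka X^{(2m+n-1)ηa}(log X)^{2ηa/(n+1)} ≤ Ψ₀`, `Kb X^{m(n+1)}(log X)^{ηb/(n+1)} ≤ Ψ₀`,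
`2Kp X^{2m+2n}(log X)^{2/(n+1)} ≤ Ψ₀³` hold at `X ≥ e`, then no nonzero `(λ, μ)` satisfies (12)
with `V = ρ/2`. [cite: Diaz1989, §II-3-4 (𝒞9) p. 14] -/
theorem C9_at (hm : 1 ≤ m) {u : Fin n → ℂ} {v : Fin m → ℂ} {ηa ηb : ℝ}
    (hηa : 0 ≤ ηa) (hηb : 0 ≤ ηb) (hηb' : (((m - 1 : ℕ) : ℝ) + 2 * (n + 1)) * ηb ≤ m * (n + 1))
    {c Δ Xa Xb : ℝ} (hc : 0 < c) (hΔ : 0 < Δ) (hXa : 0 < Xa) (hXb : 0 < Xb)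
    (hAl : ∀ lam : Fin n → ℤ, lam ≠ 0 → ∀ B : ℝ, 0 ≤ B → (∀ i, (|lam i| : ℝ) ≤ B) →
      Real.exp (-((B + Xa + 1) ^ ηa)) ≤ ‖∑ i, (lam i : ℂ) * u i‖)
    (hBl : ∀ mu : Fin m → ℤ, mu ≠ 0 → ∀ B : ℝ, 0 ≤ B → (∀ k, (|mu k| : ℝ) ≤ B) →
      Real.exp (-((B + Xb + 1) ^ ηb)) ≤ ‖∑ k, (mu k : ℂ) * v k‖)
    {X : ℝ} (hXe : Real.exp 1 ≤ X) (hX1 : 1 < X)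
    (hA1 : (c * Δ * ((a1 m n : ℝ) ^ 2 * a2 m n) + Xa + 1) ^ ηa *
        scale ((2 * ((m - 1 : ℕ) : ℝ) + (n + 1)) * ηa) (2 * (1 / (n + 1 : ℝ)) * ηa) X ≤
      scale (m * (n + 1)) 1 X)
    (hB1 : (c * Δ * ((a1 m n : ℝ) * (a2 m n) ^ 2) + Xb + 1) ^ ηb *
        scale (m * (n + 1)) (1 / (n + 1 : ℝ) * ηb) X ≤ scale (m * (n + 1)) 1 X)
    (hP1 : 2 * (c * Δ * ((a1 m n : ℝ) ^ 2 * (a2 m n) ^ 2)) *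
        scale (2 * ((m - 1 : ℕ) : ℝ) + 2 * (n + 1)) (2 * (1 / (n + 1 : ℝ))) X ≤
      scale (3 * (m * (n + 1))) 3 X)
    (lam : Fin n → ℤ) (mu : Fin m → ℤ) (hlam : lam ≠ 0) (hmu : mu ≠ 0)
    (hlamB : ∀ i, (|lam i| : ℝ) ≤
      c * Δ * ((Lp m n X - 1 : ℕ) : ℝ) ^ 2 * (((M1p m n X - 1 : ℕ) : ℝ) / (n + 1)))
    (hmuB : ∀ k, (|mu k| : ℝ) ≤
      c * Δ * ((Lp m n X - 1 : ℕ) : ℝ) * (((M1p m n X - 1 : ℕ) : ℝ) / (n + 1)) ^ 2) :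
    c * Δ * ((Lp m n X - 1 : ℕ) : ℝ) ^ 2 * (((M1p m n X - 1 : ℕ) : ℝ) / (n + 1)) ^ 2 *
        Real.exp (-(rho m n X / 2)) <
      ‖∑ i, (lam i : ℂ) * u i‖ * ‖∑ k, (mu k : ℂ) * v k‖ := by
  have _ := hm
  have hcΔ : 0 ≤ c * Δ := by positivity
  have hn0 : (0 : ℝ) ≤ n := Nat.cast_nonneg n
  have hP1' : 1 ≤ scale (m * (n + 1)) 1 X := one_le_scale (by positivity) zero_le_one hXe
  have hsA1 : 1 ≤ scale (2 * ((m - 1 : ℕ) : ℝ) + (n + 1)) (2 * (1 / (n + 1 : ℝ))) X :=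
    one_le_scale (by positivity) (by positivity) hXe
  have hsB1 : 1 ≤ scale (((m - 1 : ℕ) : ℝ) + 2 * (n + 1)) (1 / (n + 1 : ℝ)) X :=
    one_le_scale (by positivity) (by positivity) hXe
  -- the three bounds of (12) as multiples of scales
  have hbl : c * Δ * ((Lp m n X - 1 : ℕ) : ℝ) ^ 2 * (((M1p m n X - 1 : ℕ) : ℝ) / (n + 1)) ≤
      c * Δ * ((a1 m n : ℝ) ^ 2 * a2 m n) *
        scale (2 * ((m - 1 : ℕ) : ℝ) + (n + 1)) (2 * (1 / (n + 1 : ℝ))) X := by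
    have := mul_le_mul_of_nonneg_left (bound_lam_le (m := m) (n := n) hX1) hcΔ
    calc _ = c * Δ * (((Lp m n X - 1 : ℕ) : ℝ) ^ 2 * (((M1p m n X - 1 : ℕ) : ℝ) / (n + 1))) := by
          ring
      _ ≤ _ := this
      _ = _ := by ring
  have hbm : c * Δ * ((Lp m n X - 1 : ℕ) : ℝ) * (((M1p m n X - 1 : ℕ) : ℝ) / (n + 1)) ^ 2 ≤
      c * Δ * ((a1 m n : ℝ) * (a2 m n) ^ 2) *
        scale (((m - 1 : ℕ) : ℝ) + 2 * (n + 1)) (1 / (n + 1 : ℝ)) X := by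
    have := mul_le_mul_of_nonneg_left (bound_mu_le (m := m) (n := n) hX1) hcΔ
    calc _ = c * Δ * (((Lp m n X - 1 : ℕ) : ℝ) * (((M1p m n X - 1 : ℕ) : ℝ) / (n + 1)) ^ 2) := by
          ring
      _ ≤ _ := this
      _ = _ := by ring
  have hbp : c * Δ * ((Lp m n X - 1 : ℕ) : ℝ) ^ 2 * (((M1p m n X - 1 : ℕ) : ℝ) / (n + 1)) ^ 2 ≤
      c * Δ * ((a1 m n : ℝ) ^ 2 * (a2 m n) ^ 2) *
        scale (2 * ((m - 1 : ℕ) : ℝ) + 2 * (n + 1)) (2 * (1 / (n + 1 : ℝ))) X := by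
    have := mul_le_mul_of_nonneg_left (bound_prod_le (m := m) (n := n) hX1) hcΔ
    calc _ = c * Δ * (((Lp m n X - 1 : ℕ) : ℝ) ^ 2 * (((M1p m n X - 1 : ℕ) : ℝ) / (n + 1)) ^ 2) := by
          ring
      _ ≤ _ := this
      _ = _ := by ring
  -- lower bound for `|λ.u|`
  have hTa : (c * Δ * ((Lp m n X - 1 : ℕ) : ℝ) ^ 2 * (((M1p m n X - 1 : ℕ) : ℝ) / (n + 1)) +
      Xa + 1) ^ ηa ≤ scale (m * (n + 1)) 1 X := by
    have hle := shift_le_mul_scale hbl hsA1 (by linarith : 0 ≤ Xa + 1)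
    exact (rpow_le_of_le_mul_scale hX1.le (by positivity) (by positivity) hηa hle).trans hA1
  have hLu : Real.exp (-scale (m * (n + 1)) 1 X) ≤ ‖∑ i, (lam i : ℂ) * u i‖ :=
    le_trans (Real.exp_le_exp.mpr (neg_le_neg hTa)) (hAl lam hlam _ (by positivity) hlamB)
  -- lower bound for `|μ.v|`
  have hTb : (c * Δ * ((Lp m n X - 1 : ℕ) : ℝ) * (((M1p m n X - 1 : ℕ) : ℝ) / (n + 1)) ^ 2 +
      Xb + 1) ^ ηb ≤ scale (m * (n + 1)) 1 X := by
    have hle := shift_le_mul_scale hbm hsB1 (by linarith : 0 ≤ Xb + 1)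
    refine (rpow_le_of_le_mul_scale hX1.le (by positivity) (by positivity) hηb hle).trans ?_
    refine le_trans (mul_le_mul_of_nonneg_left (scale_le_scale hηb' le_rfl hXe) (by positivity)) hB1
  have hLv : Real.exp (-scale (m * (n + 1)) 1 X) ≤ ‖∑ k, (mu k : ℂ) * v k‖ :=
    le_trans (Real.exp_le_exp.mpr (neg_le_neg hTb)) (hBl mu hmu _ (by positivity) hmuB)
  -- the product of the lower bounds beats the upper bound (12)
  have hprod : Real.exp (-(2 * scale (m * (n + 1)) 1 X)) ≤
      ‖∑ i, (lam i : ℂ) * u i‖ * ‖∑ k, (mu k : ℂ) * v k‖ := by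
    calc Real.exp (-(2 * scale (m * (n + 1)) 1 X))
        = Real.exp (-scale (m * (n + 1)) 1 X) * Real.exp (-scale (m * (n + 1)) 1 X) := by
          rw [← Real.exp_add]; ring_nf
      _ ≤ _ := mul_le_mul hLu hLv (Real.exp_pos _).le (norm_nonneg _)
  have h3 : scale (3 * (m * (n + 1))) 3 X = scale (m * (n + 1)) 1 X ^ 3 := by
    rw [scale_pow hX1.le]; ring_nf
  have hsP3 : c * Δ * ((a1 m n : ℝ) ^ 2 * (a2 m n) ^ 2) *
      scale (2 * ((m - 1 : ℕ) : ℝ) + 2 * (n + 1)) (2 * (1 / (n + 1 : ℝ))) X ≤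
        scale (m * (n + 1)) 1 X ^ 3 / 2 := by
    rw [h3] at hP1; linarith
  calc c * Δ * ((Lp m n X - 1 : ℕ) : ℝ) ^ 2 * (((M1p m n X - 1 : ℕ) : ℝ) / (n + 1)) ^ 2 *
        Real.exp (-(rho m n X / 2))
      ≤ scale (m * (n + 1)) 1 X ^ 3 / 2 * Real.exp (-(16 * (n + 1) * scale (m * (n + 1)) 1 X / 2)) :=
        mul_le_mul_of_nonneg_right (hbp.trans hsP3) (Real.exp_pos _).le
    _ < Real.exp (-(2 * scale (m * (n + 1)) 1 X)) := half_cube_mul_exp_lt hP1' n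
    _ ≤ _ := hprod

/-- **(𝒞9) eventually** (Diaz 1989, §II-3-4, p. 14, and §II-4-2: the condition (𝒞9) holds for
the chosen parameters): under (HT1)(a) for `u` with an exponent `ηa ≥ 0` such that
`(2m+n-1)ηa < m(n+1)`, and (HT1)(b) for `v` with an exponent `ηb ≥ 0` such that
`(m+2n+1)ηb ≤ m(n+1)`, `ηb < n+1` (Diaz's exponents `ηa = m(n+1)/(2m+n)`,
`ηb = m(n+1)/(m+2n+1)` qualify), for all large `X` no nonzero pair `(λ, μ)` satisfies the
conclusion (12) of the zero lemma taken with `D₁ = L-1`, `S = M₁-1`, `V = ρ/2` and fixed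
`c, Δ > 0`: the measures give `|λ.u|·|μ.v| ≥ exp(-2Ψ₀)`, while (12) would force
`|λ.u|·|μ.v| ≤ cΔ(L-1)²((M₁-1)/(n+1))² e^{-ρ/2} ≤ Ψ₀³ e^{-8(n+1)Ψ₀}/2`.
[cite: Diaz1989, §II-3-4 (𝒞9) p. 14] -/
theorem eventually_C9 (hm : 1 ≤ m) {u : Fin n → ℂ} {v : Fin m → ℂ} {ηa ηb : ℝ}
    (hA : Diaz1989.MeasureA u ηa) (hB : Diaz1989.MeasureB v ηb)
    (hηa : 0 ≤ ηa) (hηa' : (2 * ((m - 1 : ℕ) : ℝ) + (n + 1)) * ηa < m * (n + 1))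
    (hηb : 0 ≤ ηb) (hηb' : (((m - 1 : ℕ) : ℝ) + 2 * (n + 1)) * ηb ≤ m * (n + 1))
    (hηb'' : ηb < n + 1) {c Δ : ℝ} (hc : 0 < c) (hΔ : 0 < Δ) :
    ∀ᶠ X in atTop, ∀ (lam : Fin n → ℤ) (mu : Fin m → ℤ), lam ≠ 0 → mu ≠ 0 →
      (∀ i, (|lam i| : ℝ) ≤
        c * Δ * ((Lp m n X - 1 : ℕ) : ℝ) ^ 2 * (((M1p m n X - 1 : ℕ) : ℝ) / (n + 1))) →
      (∀ k, (|mu k| : ℝ) ≤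
        c * Δ * ((Lp m n X - 1 : ℕ) : ℝ) * (((M1p m n X - 1 : ℕ) : ℝ) / (n + 1)) ^ 2) →
      c * Δ * ((Lp m n X - 1 : ℕ) : ℝ) ^ 2 * (((M1p m n X - 1 : ℕ) : ℝ) / (n + 1)) ^ 2 *
          Real.exp (-(rho m n X / 2)) <
        ‖∑ i, (lam i : ℂ) * u i‖ * ‖∑ k, (mu k : ℂ) * v k‖ := by
  obtain ⟨Xa, hXa, hAl⟩ := MeasureA.lower hA
  obtain ⟨Xb, hXb, hBl⟩ := MeasureB.lower hB
  have hn0 : (0 : ℝ) ≤ n := Nat.cast_nonneg n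
  have hbB1 : 1 / (n + 1 : ℝ) * ηb < 1 := by
    rw [one_div_mul_eq_div, div_lt_one (by positivity)]; exact hηb''
  have hlt3 : 2 * ((m - 1 : ℕ) : ℝ) + 2 * (n + 1) < 3 * (m * (n + 1)) := by
    have h1 : ((m - 1 : ℕ) : ℝ) = m - 1 := by rw [Nat.cast_sub hm]; simp
    have hm1 : (1 : ℝ) ≤ m := by exact_mod_cast hm
    rw [h1]; nlinarith
  filter_upwards [eventually_mul_scale_le_of_lt hηa' (2 * (1 / (n + 1 : ℝ)) * ηa) 1
      ((c * Δ * ((a1 m n : ℝ) ^ 2 * a2 m n) + Xa + 1) ^ ηa),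
    eventually_mul_scale_le_of_lt_right ((m : ℝ) * (n + 1)) hbB1
      ((c * Δ * ((a1 m n : ℝ) * (a2 m n) ^ 2) + Xb + 1) ^ ηb),
    eventually_mul_scale_le_of_lt hlt3 (2 * (1 / (n + 1 : ℝ))) 3
      (2 * (c * Δ * ((a1 m n : ℝ) ^ 2 * (a2 m n) ^ 2))),
    eventually_ge_atTop (Real.exp 1), eventually_gt_atTop (1 : ℝ)]
    with X hA1 hB1 hP1 hXe hX1 lam mu hlam hmu hlamB hmuB
  exact C9_at hm hηa hηb hηb' hc hΔ hXa hXb hAl hBl hXe hX1 hA1 (by exact_mod_cast hB1) hP1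
    lam mu hlam hmu hlamB hmuB


/-! ### The hypotheses (10) of the zero lemma in the ball `𝓑_ρ` -/

/-- `Δ₀ = ∑_{h,k} (|u_hv_k| + 1) + π ∑_h |u_h| + π`, an admissible `Δ` in (10) for every point of
the ball `𝓑_ρ` (Diaz takes `Δ` with `max(∑|z_hk|, π|u₁|, π) ≤ Δ`). [cite: Diaz1989, §II-3-4 (10) p. 12] -/
def Delta0 (u : Fin n → ℂ) (v : Fin m → ℂ) : ℝ :=
  (∑ h, ∑ k, (‖u h * v k‖ + 1)) + Real.pi * (∑ h, ‖u h‖) + Real.pi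

/-- `Δ₀ > 0`. [folklore] -/
theorem Delta0_pos (u : Fin n → ℂ) (v : Fin m → ℂ) : 0 < Delta0 u v := by
  unfold Delta0
  have h1 : 0 ≤ ∑ h, ∑ k, (‖u h * v k‖ + 1) :=
    Finset.sum_nonneg fun h _ => Finset.sum_nonneg fun k _ => by positivity
  have h2 : 0 ≤ Real.pi * ∑ h, ‖u h‖ :=
    mul_nonneg Real.pi_pos.le (Finset.sum_nonneg fun h _ => norm_nonneg _)
  linarith [Real.pi_pos]

/-- **The hypotheses (10) hold in the ball `𝓑_ρ` with `V = ρ/2`, `Δ = Δ₀`**, as soon as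
`ρ ≥ 4(∑_{h,k}|e^{-u_hv_k}| + m + 1)`: for `θ̃` with `max|θ̃ᵢ - θᵢ| ≤ e^{-ρ}` all `θ̃_hk ≠ 0`,
`∑|z_hk - u_hv_k| < e^{-ρ/2}`, `∑|θ̃_k - v_k| < e^{-ρ/2}`, `∑|z_hk| ≤ Δ₀`, `π|u₁| ≤ Δ₀`, `π ≤ Δ₀`
(Diaz, p. 14: "On pose `V = ρ - c₁₅`"). [cite: Diaz1989, §II-3-4 (10) p. 12 and p. 14] -/
theorem ball_hyps (hn : 1 ≤ n) (u : Fin n → ℂ) (v : Fin m → ℂ) {X : ℝ}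
    (hρ : 4 * ((∑ h, ∑ k, ‖Complex.exp (-(u h * v k))‖) + m + 1) ≤ rho m n X)
    {θ' : Var m n → ℂ} (hθ' : ∀ i, ‖theta u v i - θ' i‖ ≤ Real.exp (-rho m n X)) :
    (∀ h k, θ' (Sum.inr (h, k)) ≠ 0) ∧
    (∑ h, ∑ k, ‖zlog u v θ' h k - u h * v k‖) < Real.exp (-(rho m n X / 2)) ∧
    (∑ k, ‖θ' (Sum.inl k) - v k‖) < Real.exp (-(rho m n X / 2)) ∧
    (∑ h, ∑ k, ‖zlog u v θ' h k‖) ≤ Delta0 u v ∧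
    Real.pi * ‖u ⟨0, hn⟩‖ ≤ Delta0 u v ∧ Real.pi ≤ Delta0 u v := by
  set ρ := rho m n X with hρdef
  set E : ℝ := ∑ h, ∑ k, ‖Complex.exp (-(u h * v k))‖ with hEdef
  set ε : ℝ := Real.exp (-ρ) with hεdef
  have hE0 : 0 ≤ E := Finset.sum_nonneg fun h _ => Finset.sum_nonneg fun k _ => norm_nonneg _
  have hm0 : (0 : ℝ) ≤ m := Nat.cast_nonneg m
  have hε0 : 0 < ε := Real.exp_pos _
  -- `ε E ≤ 1/4`
  have hεE : ε * E ≤ 1 / 4 := by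
    have h1 : ρ + 1 ≤ Real.exp ρ := Real.add_one_le_exp ρ
    have h2 : ε * Real.exp ρ = 1 := by rw [hεdef, ← Real.exp_add]; simp
    have h3 : ε * (ρ + 1) ≤ ε * Real.exp ρ := mul_le_mul_of_nonneg_left h1 hε0.le
    rw [h2] at h3
    nlinarith
  -- `e^{ρ/2} > ρ/2 ≥ 2(E + m + 1)`
  have hexp : Real.exp (-(ρ / 2)) = Real.exp (ρ / 2) * ε := by
    rw [hεdef, ← Real.exp_add]; ring_nf
  have hhalf : 2 * (E + m + 1) < Real.exp (ρ / 2) := by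
    have := Real.add_one_le_exp (ρ / 2); linarith
  -- pointwise facts at `Y_hk`
  have hdist : ∀ h k, ‖θ' (Sum.inr (h, k)) - Complex.exp (u h * v k)‖ ≤ ε := fun h k => by
    rw [norm_sub_rev]; simpa using hθ' (Sum.inr (h, k))
  have ht : ∀ h k, ‖θ' (Sum.inr (h, k)) - Complex.exp (u h * v k)‖ *
      ‖Complex.exp (-(u h * v k))‖ ≤ ε * ‖Complex.exp (-(u h * v k))‖ := fun h k =>
    mul_le_mul_of_nonneg_right (hdist h k) (norm_nonneg _)
  have hle_E : ∀ h k, ‖Complex.exp (-(u h * v k))‖ ≤ E := fun h k => by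
    rw [hEdef]
    refine le_trans ?_ (Finset.single_le_sum (f := fun h => ∑ k, ‖Complex.exp (-(u h * v k))‖)
      (fun h _ => Finset.sum_nonneg fun k _ => norm_nonneg _) (Finset.mem_univ h))
    exact Finset.single_le_sum (f := fun k => ‖Complex.exp (-(u h * v k))‖)
      (fun k _ => norm_nonneg _) (Finset.mem_univ k)
  have ht4 : ∀ h k, ‖θ' (Sum.inr (h, k)) - Complex.exp (u h * v k)‖ *
      ‖Complex.exp (-(u h * v k))‖ ≤ 1 / 4 := fun h k =>
    (ht h k).trans ((mul_le_mul_of_nonneg_left (hle_E h k) hε0.le).trans hεE)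
  have hne : ∀ h k, θ' (Sum.inr (h, k)) ≠ 0 := by
    intro h k h0
    have h1 := ht4 h k
    rw [h0, zero_sub, norm_neg, ← norm_mul, ← Complex.exp_add, add_neg_cancel, Complex.exp_zero,
      norm_one] at h1
    norm_num at h1
  have hz : ∀ h k, ‖zlog u v θ' h k - u h * v k‖ ≤
      3 / 2 * (ε * ‖Complex.exp (-(u h * v k))‖) := fun h k =>
    (norm_zlog_sub_le u v h k ((ht4 h k).trans (by norm_num))).trans
      (mul_le_mul_of_nonneg_left (ht h k) (by norm_num))
  refine ⟨hne, ?_, ?_, ?_, ?_, ?_⟩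
  · -- (10a)
    calc (∑ h, ∑ k, ‖zlog u v θ' h k - u h * v k‖)
        ≤ ∑ h, ∑ k, 3 / 2 * (ε * ‖Complex.exp (-(u h * v k))‖) :=
          Finset.sum_le_sum fun h _ => Finset.sum_le_sum fun k _ => hz h k
      _ = 3 / 2 * E * ε := by
          rw [hEdef]; simp only [← Finset.mul_sum]; ring
      _ < Real.exp (ρ / 2) * ε := mul_lt_mul_of_pos_right (by linarith) hε0
      _ = Real.exp (-(ρ / 2)) := hexp.symm
  · -- (10b)
    calc (∑ k, ‖θ' (Sum.inl k) - v k‖) ≤ ∑ _k : Fin m, ε :=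
          Finset.sum_le_sum fun k _ => by
            rw [norm_sub_rev]; simpa using hθ' (Sum.inl k)
      _ = m * ε := by simp
      _ < Real.exp (ρ / 2) * ε := mul_lt_mul_of_pos_right (by linarith) hε0
      _ = Real.exp (-(ρ / 2)) := hexp.symm
  · -- (10c)
    have hz1 : ∀ h k, ‖zlog u v θ' h k‖ ≤ ‖u h * v k‖ + 1 := fun h k => by
      have h1 : ‖zlog u v θ' h k‖ ≤ ‖u h * v k‖ + ‖zlog u v θ' h k - u h * v k‖ := by
        have := norm_add_le (u h * v k) (zlog u v θ' h k - u h * v k)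
        rwa [add_sub_cancel] at this
      have h2 : ‖zlog u v θ' h k - u h * v k‖ ≤ 1 := by
        refine (norm_zlog_sub_le u v h k ((ht4 h k).trans (by norm_num))).trans ?_
        linarith [ht4 h k]
      linarith
    calc (∑ h, ∑ k, ‖zlog u v θ' h k‖) ≤ ∑ h, ∑ k, (‖u h * v k‖ + 1) :=
          Finset.sum_le_sum fun h _ => Finset.sum_le_sum fun k _ => hz1 h k
      _ ≤ Delta0 u v := by
          unfold Delta0
          have : 0 ≤ Real.pi * ∑ h, ‖u h‖ :=
            mul_nonneg Real.pi_pos.le (Finset.sum_nonneg fun h _ => norm_nonneg _)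
          linarith [Real.pi_pos]
  · -- (10d)
    unfold Delta0
    have h1 : ‖u ⟨0, hn⟩‖ ≤ ∑ h, ‖u h‖ :=
      Finset.single_le_sum (f := fun h => ‖u h‖) (fun h _ => norm_nonneg _) (Finset.mem_univ _)
    have h2 : 0 ≤ ∑ h, ∑ k, (‖u h * v k‖ + 1) :=
      Finset.sum_nonneg fun h _ => Finset.sum_nonneg fun k _ => by positivity
    have h3 := mul_le_mul_of_nonneg_left h1 Real.pi_pos.le
    linarith [Real.pi_pos]
  · -- (10e)
    unfold Delta0
    have h2 : 0 ≤ ∑ h, ∑ k, (‖u h * v k‖ + 1) :=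
      Finset.sum_nonneg fun h _ => Finset.sum_nonneg fun k _ => by positivity
    have : 0 ≤ Real.pi * ∑ h, ‖u h‖ :=
      mul_nonneg Real.pi_pos.le (Finset.sum_nonneg fun h _ => norm_nonneg _)
    linarith

/-! ### No zero in the ball -/

/-- **§II-3-4, conclusion: the `Q_{μj}`, `|μ| < M₁`, have no common zero in `𝓑_ρ`** (Diaz 1989,
p. 14: "Les conditions (10) et (11) du lemme de zéros sont remplies, mais pas la conclusion (12)
[by (𝒞9)]. Donc … il existe `μ ∈ ℕ^m(M₁)` tel que `Q_{μj(θ̃)}(θ̃) ≠ 0`"). Given the zero lemma at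
`n` (constant `c`), `ℚ`-linearly independent `u, v` with (HT1)(a), (b) (exponents as in
`eventually_C9`), for all large `X`: for every `θ̃` with `max|θ̃ᵢ - θᵢ| ≤ e^{-ρ}`, every family of
unknowns `p` (parameters `D, L` at `X`, any `M`) and every minimal index `j` at `θ̃`, some
`Q_{μj}(θ̃)`, `|μ| < M₁`, is non-zero. [cite: Diaz1989, §II-3-4 pp. 12–14] -/
theorem eventually_zeroFree (hn : 1 ≤ n) (hm : 2 ≤ m) {c : ℝ} (hc : 0 < c)
    (hZc : ZeroLemmaAt n hn c) {u : Fin n → ℂ} {v : Fin m → ℂ} (hu : LinearIndependent ℚ u)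
    (hv : LinearIndependent ℚ v) {ηa ηb : ℝ}
    (hA : Diaz1989.MeasureA u ηa) (hB : Diaz1989.MeasureB v ηb)
    (hηa : 0 ≤ ηa) (hηa' : (2 * ((m - 1 : ℕ) : ℝ) + (n + 1)) * ηa < m * (n + 1))
    (hηb : 0 ≤ ηb) (hηb' : (((m - 1 : ℕ) : ℝ) + 2 * (n + 1)) * ηb ≤ m * (n + 1))
    (hηb'' : ηb < n + 1) :
    ∀ᶠ X in atTop, ∀ (M : ℕ) (p : Unk m n (Dp m n X) (Lp m n X) M → ℤ) (θ' : Var m n → ℂ),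
      (∀ i, ‖theta u v i - θ' i‖ ≤ Real.exp (-rho m n X)) →
      ∀ j : Var m n →₀ ℕ, IsMinIdx p θ' j →
        ∃ μ : Fin m → ℕ, (∀ k, μ k < M1p m n X) ∧ aeval θ' (Qj p μ j) ≠ 0 := by
  have hm1 : 1 ≤ m := by omega
  have hΔ := Delta0_pos u v
  have hρ4 : ∀ᶠ X in atTop,
      4 * ((∑ h, ∑ k, ‖Complex.exp (-(u h * v k))‖) + m + 1) ≤ rho m n X := by
    have h := eventually_const_le_scale (a := (m : ℝ) * (n + 1)) (b := 1) (Or.inl (by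
      have : (1 : ℝ) ≤ m := by exact_mod_cast hm1
      positivity)) (4 * ((∑ h, ∑ k, ‖Complex.exp (-(u h * v k))‖) + m + 1))
    filter_upwards [h, eventually_ge_atTop (1 : ℝ)] with X hX hX1
    have hs := scale_nonneg (a := (m : ℝ) * (n + 1)) (b := 1) hX1
    have hn0 : (0 : ℝ) ≤ n := Nat.cast_nonneg n
    calc _ ≤ scale (m * (n + 1)) 1 X := hX
      _ ≤ 16 * (n + 1) * scale (m * (n + 1)) 1 X := by nlinarith
      _ = rho m n X := rfl
  filter_upwards [hρ4, eventually_D_ge (m := m) (n := n) (by omega), eventually_L_ge (m := m) (n := n),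
    eventually_M_ge (n := n), eventually_C7 (n := n) hm1, eventually_C8 hm hn,
    eventually_C9 hm1 hA hB hηa hηa' hηb hηb' hηb'' hc hΔ, eventually_gt_atTop (0 : ℝ)]
    with X hρ hD hL hM h7 h8 h9 hX0 M p θ' hθ' j hj
  obtain ⟨hne, h10a, h10b, h10c, h10d, h10e⟩ := ball_hyps hn u v hρ hθ'
  have hρpos : 0 < rho m n X / 2 := by
    have hE : 0 ≤ ∑ h, ∑ k, ‖Complex.exp (-(u h * v k))‖ :=
      Finset.sum_nonneg fun h _ => Finset.sum_nonneg fun k _ => norm_nonneg _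
    have hm0 : (0 : ℝ) ≤ m := Nat.cast_nonneg m
    linarith
  have hM₁ : 2 ≤ M1p m n X := by
    unfold M1p
    calc 2 ≤ 1 * 2 := by norm_num
      _ ≤ a2 m n * Mp n X := Nat.mul_le_mul one_le_a2 hM.2
  rcases exists_aeval_Qj_ne_zero_or hn hm hZc u v hu hv p hj hne hρpos hΔ h10a h10b h10c h10d
      h10e hD.2 hL.2 hM₁ h7 h8 with h | ⟨lam, mu, hlam, hmu, hl, hμ, hprod⟩
  · exact h
  · exact absurd hprod (not_le.mpr (h9 lam mu hlam hmu hl hμ))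

end DiazThm1

end Literature.NumberTheory.Transcendental

end
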